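import Summits.BirchSwinnertonDyer.BirchSwinnertonDyer.Theorems.ResidualThetaTransportAtTwoThetaLayerLambdaCongruenceAtTwoStarGalois
import Summits.BirchSwinnertonDyer.BirchSwinnertonDyer.Theorems.ResidualThetaTransportAtTwoThetaLayerLambdaCongruenceAtTwoStarAssembly
import HarnessLib

/-!
# Route `ResidualThetaTransportAtTwo`, crux Kμ⁺ `SignedMuVanishingAtTwoPlus` (stmt-BirchSwinnertonDyer-20689), line
# `birth`, stub `stub_flatMuZeroAtTwo`: the (MO⁺) DICTIONARY, part 4 — hypothesis (I) «at most four mod-2 eigencharacters»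
# for the habitat⁺ newform FROM THE NAMED FACTS {Buzzard 2000 Prop. 2.4, Serre 1972 Prop. 12, DDT Lemma 1.38}

Cell `bsd-wall`, width seat `bsd-wall-rtt-p4-w2` (g4). THEOREMS ONLY (no `def`, no `sorry`); helper `--supports` the crux; closes
nothing. BSD is not proved by this. This file REUSES the Galois/self-duality layer that the sibling crux Kan⁺
(`ThetaLayerLambdaCongruenceAtTwo`, stmt-…-20688, width seat rtt-p3-w3) landed for its index statement (K2):
`finrank_torsionBySet_eq_two_of_facts` (Buzzard's hypotheses at a mod-2 eigen-ideal of a good-supersingular-at-2 curve,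
discharged from Serre's Prop. 12) and `exists_fourCosets_periodHomology_of_multiplicityOne` (sub form ⟹ «`Λ/𝔪Λ` has at most
four cosets» through the Hecke self-duality of `J₀(N)[2]`). So the (MO⁺) dictionary of THIS crux and (K2) of Kan⁺ rest on the
SAME three named facts.

## What is proved
* `exists_descend_eigenChar` — a map `χ : Γ₀(N) → ZMod 2` that is additive, factors through `γ ↦ {∞,γ∞}` and is a Hecke
  eigencharacter (`χ σ = (A p) χ γ` whenever `{∞,σ∞} = T_p^∨{∞,γ∞}`, all `p`) descends to an additive `χ̃ : Λ → 𝔽₂`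
  (`Λ = periodHomologyHecke N`) with `χ̃(u • x) = ev_f(u) χ̃(x)` for every `u ∈ 𝕋_ℤ` (induction on `ℤ[T_p]`); hence `χ̃`
  kills `𝔪 • Λ` for every ideal `𝔪` acting on `f` by EVEN integers.
* `card_eigenChar_le_four_of_fourCosets` — if moreover `Λ ⊆ 𝔪Λ ∪ (v₁+𝔪Λ) ∪ (v₂+𝔪Λ) ∪ (v₁+v₂+𝔪Λ)`, every finite set of such
  `χ` has at most `4` elements (`χ` is determined by `(χ̃ v₁, χ̃ v₂) ∈ 𝔽₂²`).
* `card_eigenChar_le_four_of_facts` — for `W/ℚ` globally minimal, good supersingular at `2`, with newform `f` (level `N_W`,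
  eigenvalues `A p = a_p(W)`): hypothesis (I) `hfour` of `…MultOneFlat.multOnePlus_of_card_le_four` FROM
  `buzzard2000_multiplicityOne_gamma0`, `serre1972_supersingular_decompositionSubgroup_image`, `heckeSelfDual_torsionBy_J0`
  — at the eigen-ideal `𝔪₀ = (2, T_p − a_p(W) : p prime)`, which is proper (it acts on `f ≠ 0` by even integers), has
  `|𝕋/𝔪₀| = 2` and is maximal (sibling lemmas `natCard_quotient_eq_two_of_ne_top`, `isMaximal_of_natCard_quotient_eq_two`).

References: K. Buzzard, Math. Res. Lett. 7 (2000) Prop. 2.4 [Buzzard2000LevelLoweringModTwo]; J.-P. Serre, Invent. Math. 15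
(1972) §1.11 Prop. 12 [SerreInventiones1972]; H. Darmon, F. Diamond, R. Taylor, *Fermat's Last Theorem* §1.6 Lemma 1.38, §4.5
[DarmonDiamondTaylor1995].
-/

set_option autoImplicit false
set_option linter.dupNamespace false

noncomputable section

open scoped Classical MatrixGroups ModularForm NumberField

open CongruenceSubgroup Polynomial IsDedekindDomain WeierstrassCurve Literature.NumberTheory.EllipticCurves
  Literature.NumberTheory.EllipticCurves.ModularForms Literature.NumberTheory.EllipticCurves.Rank1Residual
  Literature.NumberTheory.GaloisRepresentations Rat.HeightOneSpectrum
  Summit.BirchSwinnertonDyer.BirchSwinnertonDyer.Theorems.ThetaLayerLambdaCongruenceAtTwo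

namespace Summit.BirchSwinnertonDyer.BirchSwinnertonDyer.Theorems.SignedMuAtTwo

namespace MultOneDictionary

/-! ## §1. Eigencharacters descend to `Λ` and kill `𝔪 • Λ` -/

section Descend

variable {N : ℕ} [NeZero N]

/-- **Descent of a mod-2 Hecke eigencharacter to the period homology.** Let `T_p f = (A p) f` for all primes `p` (integers
`A p`) and let `χ : Γ₀(N) → ZMod 2` be additive, factor through `γ ↦ {∞, γ∞}`, and satisfy `χ σ = (A p) χ γ` whenever
`{∞,σ∞} = T_p^∨{∞,γ∞}`. Then there is an additive `χ̃ : Λ → ZMod 2` on `Λ = periodHomologyHecke N` with `χ̃({∞,γ∞}) = χ γ`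
and, for every `u ∈ 𝕋_ℤ`, an integer eigenvalue `n` (`u f = n f`) with `χ̃(u • x) = n χ̃(x)` for all `x ∈ Λ` (Manin: `Λ`
consists of the `{∞,γ∞}`; induction on `ℤ[T_p]`). [cite: DarmonDiamondTaylor1995, §1.3 (p. 32) and §1.6 (p. 41)] -/
theorem exists_descend_eigenChar (f : CuspForm (Gamma0 N) 2) (A : ℕ → ℤ)
    (hAT : ∀ (p : ℕ) (hp : p.Prime), (haveI : NeZero p := ⟨hp.ne_zero⟩; heckeT (Gamma0 N) 2 p) f = ((A p : ℤ) : ℂ) • f)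
    (χ : Gamma0 N → ZMod 2)
    (ha : ∀ γ γ' : Gamma0 N, χ (γ * γ') = χ γ + χ γ')
    (hb : ∀ γ γ' : Gamma0 N, periodFunctional N γ = periodFunctional N γ' → χ γ = χ γ')
    (hd : ∀ (p : ℕ) (hp : p.Prime) (γ σ : Gamma0 N),
      periodFunctional N σ = (haveI : NeZero p := ⟨hp.ne_zero⟩; heckeT (Gamma0 N) 2 p).dualMap (periodFunctional N γ) →
      χ σ = ((A p : ℤ) : ZMod 2) * χ γ) :
    ∃ χt : periodHomologyHecke N →+ ZMod 2,
      (∀ γ : Gamma0 N, χt ⟨periodFunctional N γ, periodFunctional_mem_periodHomology N γ⟩ = χ γ) ∧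
      ∀ u : HeckeRing0 N 2, ∃ n : ℤ, HeckeRing0.toEnd N 2 u f = (n : ℂ) • f ∧
        ∀ x : periodHomologyHecke N, χt (u • x) = (n : ZMod 2) * χt x := by
  classical
  have hsurj : ∀ x : periodHomologyHecke N, ∃ γ : Gamma0 N, periodFunctional N γ = x := by
    intro x
    have hx : (x : Module.Dual ℂ (CuspForm (Gamma0 N) 2)) ∈ (periodHomology N : Set _) := x.2
    rw [coe_periodHomology_eq_range] at hx
    exact hx
  choose γof hγof using hsurj
  have hχ1 : χ 1 = 0 := by
    have h := ha 1 1
    rw [mul_one] at h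
    have h2 : χ 1 + χ 1 = 0 := ZModModule.add_self _
    rw [← h] at h2
    exact h2
  let χt : periodHomologyHecke N →+ ZMod 2 :=
    { toFun := fun x ↦ χ (γof x)
      map_zero' := by
        have h : periodFunctional N (γof 0) = periodFunctional N 1 := by rw [hγof, periodFunctional_one]; rfl
        rw [hb _ _ h, hχ1]
      map_add' := fun x y ↦ by
        have h : periodFunctional N (γof (x + y)) = periodFunctional N (γof x * γof y) := by
          rw [periodFunctional_mul, hγof, hγof, hγof]; rfl
        rw [hb _ _ h, ha] }
  have hχt : ∀ x, χt x = χ (γof x) := fun _ ↦ rfl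
  have hχt_per : ∀ γ : Gamma0 N, χt ⟨periodFunctional N γ, periodFunctional_mem_periodHomology N γ⟩ = χ γ := fun γ ↦ by
    rw [hχt]; exact hb _ _ (hγof _)
  refine ⟨χt, hχt_per, fun u ↦ ?_⟩
  -- induction on `𝕋_ℤ = ℤ[T_p]`, for the underlying endomorphism
  suffices key : ∀ (e : Module.End ℂ (CuspForm (Gamma0 N) 2)) (he : e ∈ heckeRing0 N 2), ∃ n : ℤ, e f = (n : ℂ) • f ∧
      ∀ x : periodHomologyHecke N, ∀ hx : e.dualMap (x : Module.Dual ℂ (CuspForm (Gamma0 N) 2)) ∈ periodHomologyHecke N,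
        χt ⟨e.dualMap x, hx⟩ = (n : ZMod 2) * χt x by
    obtain ⟨n, hn, hkey⟩ := key _ (HeckeRing0.toEnd_mem N 2 u)
    exact ⟨n, hn, fun x ↦ hkey x (u • x).2⟩
  intro e he
  change e ∈ Algebra.adjoin ℤ (heckeRing0Generators N 2) at he
  induction he using Algebra.adjoin_induction with
  | mem e he =>
    obtain ⟨p, hp, rfl⟩ := he
    refine ⟨A p, hAT p hp, fun x hx ↦ ?_⟩
    rw [hχt, hχt]
    apply hd p hp
    rw [hγof, hγof]
  | algebraMap r =>
    refine ⟨r, by rw [Algebra.algebraMap_eq_smul_one, LinearMap.smul_apply, Module.End.one_apply, Int.cast_smul_eq_zsmul], ?_⟩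
    intro x hx
    have hx' : (⟨(algebraMap ℤ (Module.End ℂ (CuspForm (Gamma0 N) 2)) r).dualMap x, hx⟩ : periodHomologyHecke N) = r • x := by
      apply Subtype.ext
      change (algebraMap ℤ (Module.End ℂ (CuspForm (Gamma0 N) 2)) r).dualMap x = ((r • x : periodHomologyHecke N) : _)
      rw [Submodule.coe_smul_of_tower]
      ext g
      rw [LinearMap.dualMap_apply, Algebra.algebraMap_eq_smul_one, LinearMap.smul_apply, Module.End.one_apply,
        LinearMap.smul_apply, map_zsmul]
    rw [hx', map_zsmul, zsmul_eq_mul]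
  | add e e' _ _ he he' =>
    obtain ⟨m, hm, hme⟩ := he
    obtain ⟨n, hn, hne⟩ := he'
    refine ⟨m + n, by rw [LinearMap.add_apply, hm, hn, Int.cast_add, add_smul], fun x hx ↦ ?_⟩
    have h1 : e.dualMap (x : Module.Dual ℂ (CuspForm (Gamma0 N) 2)) ∈ periodHomologyHecke N :=
      (mem_periodHomologyHecke N).mpr (heckeRing0.dualMap_mem_periodHomology N ‹_› x.2)
    have h2 : e'.dualMap (x : Module.Dual ℂ (CuspForm (Gamma0 N) 2)) ∈ periodHomologyHecke N :=
      (mem_periodHomologyHecke N).mpr (heckeRing0.dualMap_mem_periodHomology N ‹_› x.2)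
    have hx' : (⟨(e + e').dualMap x, hx⟩ : periodHomologyHecke N) = ⟨e.dualMap x, h1⟩ + ⟨e'.dualMap x, h2⟩ := by
      apply Subtype.ext
      change (e + e').dualMap x = e.dualMap x + e'.dualMap x
      ext g; simp only [LinearMap.dualMap_apply, LinearMap.add_apply, map_add]
    rw [hx', map_add, hme x h1, hne x h2, Int.cast_add, add_mul]
  | mul e e' he₀ he₀' he he' =>
    obtain ⟨m, hm, hme⟩ := he
    obtain ⟨n, hn, hne⟩ := he'
    refine ⟨m * n, by rw [Module.End.mul_apply, hn, LinearMap.map_smul, hm, smul_smul, Int.cast_mul, mul_comm], fun x hx ↦ ?_⟩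
    -- `(e e')^∨ x = e'^∨ (e^∨ x)`
    have h1 : e.dualMap (x : Module.Dual ℂ (CuspForm (Gamma0 N) 2)) ∈ periodHomologyHecke N :=
      (mem_periodHomologyHecke N).mpr (heckeRing0.dualMap_mem_periodHomology N he₀ x.2)
    have h2 : e'.dualMap (e.dualMap (x : Module.Dual ℂ (CuspForm (Gamma0 N) 2))) ∈ periodHomologyHecke N :=
      (mem_periodHomologyHecke N).mpr (heckeRing0.dualMap_mem_periodHomology N he₀' h1)
    have hx' : (⟨(e * e').dualMap x, hx⟩ : periodHomologyHecke N) = ⟨e'.dualMap (e.dualMap x), h2⟩ := by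
      apply Subtype.ext
      change (e * e').dualMap x = e'.dualMap (e.dualMap x)
      ext g; simp only [LinearMap.dualMap_apply, Module.End.mul_apply]
    rw [hx', hne ⟨e.dualMap x, h1⟩ h2, hme x h1, ← mul_assoc, Int.cast_mul, mul_comm (n : ZMod 2)]

/-- **Eigencharacters kill `𝔪 • Λ` for an ideal acting on `f` by even integers.** With `χ̃` as in `exists_descend_eigenChar`
and an ideal `𝔪 ⊆ 𝕋_ℤ` such that every `t ∈ 𝔪` acts on `f ≠ 0` by an even integer: `χ̃` vanishes on `𝔪 • Λ`.
[cite: DarmonDiamondTaylor1995, §1.6 (p. 41)] -/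
theorem descend_eigenChar_apply_eq_zero_of_mem_ideal_smul (f : CuspForm (Gamma0 N) 2) (hf0 : f ≠ 0)
    (χt : periodHomologyHecke N →+ ZMod 2)
    (hχt : ∀ u : HeckeRing0 N 2, ∃ n : ℤ, HeckeRing0.toEnd N 2 u f = (n : ℂ) • f ∧
      ∀ x : periodHomologyHecke N, χt (u • x) = (n : ZMod 2) * χt x)
    (𝔪 : Ideal (HeckeRing0 N 2)) (h𝔪 : ∀ t ∈ 𝔪, ∃ e : ℤ, HeckeRing0.toEnd N 2 t f = ((2 * e : ℤ) : ℂ) • f)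
    {z : Module.Dual ℂ (CuspForm (Gamma0 N) 2)} (hz : z ∈ 𝔪 • periodHomologyHecke N)
    (hzΛ : z ∈ periodHomologyHecke N) : χt ⟨z, hzΛ⟩ = 0 := by
  have huniq : ∀ m n : ℤ, (m : ℂ) • f = (n : ℂ) • f → m = n := by
    intro m n h
    have h' : ((m : ℂ) - n) • f = 0 := by rw [sub_smul, h, sub_self]
    rcases smul_eq_zero.mp h' with h1 | h1
    · exact_mod_cast sub_eq_zero.mp h1
    · exact absurd h1 hf0
  suffices key : ∃ hzΛ : z ∈ periodHomologyHecke N, χt ⟨z, hzΛ⟩ = 0 by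
    obtain ⟨_, h⟩ := key; exact h
  refine Submodule.smul_induction_on (p := fun z ↦ ∃ hzΛ : z ∈ periodHomologyHecke N, χt ⟨z, hzΛ⟩ = 0) hz
    (fun t ht x hx ↦ ?_) (fun x y hx hy ↦ ?_)
  · obtain ⟨n, hn, hχn⟩ := hχt t
    obtain ⟨e, he⟩ := h𝔪 t ht
    have hne : n = 2 * e := huniq _ _ (hn.symm.trans he)
    refine ⟨(t • (⟨x, hx⟩ : periodHomologyHecke N)).2, ?_⟩
    have : (⟨t • x, (t • (⟨x, hx⟩ : periodHomologyHecke N)).2⟩ : periodHomologyHecke N) = t • ⟨x, hx⟩ := Subtype.ext rfl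
    rw [this, hχn, hne, Int.cast_mul, Int.cast_ofNat, show (2 : ZMod 2) = 0 from rfl, zero_mul, zero_mul]
  · obtain ⟨hxΛ, hx0⟩ := hx
    obtain ⟨hyΛ, hy0⟩ := hy
    refine ⟨add_mem hxΛ hyΛ, ?_⟩
    have : (⟨x + y, add_mem hxΛ hyΛ⟩ : periodHomologyHecke N) = ⟨x, hxΛ⟩ + ⟨y, hyΛ⟩ := Subtype.ext rfl
    rw [this, map_add, hx0, hy0, add_zero]

end Descend

/-! ## §2. Four cosets of `𝔪Λ` ⟹ at most four eigencharacters -/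

section FourCosets

variable {N : ℕ} [NeZero N]

/-- **(I) from four cosets.** Let `T_p f = (A p) f` (all `p`, `f ≠ 0`), `𝔪 ⊆ 𝕋_ℤ` an ideal acting on `f` by even integers, and
suppose `Λ = periodHomology N` is covered by the four `𝔪Λ`-cosets of `0, v₁, v₂, v₁ + v₂` (mod-2 multiplicity one in quotient
form, `…StarFourCosets.exists_fourCosets_periodHomology_of_multiplicityOne`). Then every finite set of maps `χ : Γ₀(N) → ZMod 2`
that are additive, factor through the period functional and are Hecke eigencharacters with `A p mod 2` at all primes has at most
`4` elements: `χ̃` kills `𝔪Λ` (§1), so `χ` is determined by `(χ γ₁, χ γ₂)` where `{∞,γᵢ∞} = vᵢ`.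
[cite: DarmonDiamondTaylor1995, §1.6 Lemma 1.38 and §4.5 Thm. 4.26] -/
theorem card_eigenChar_le_four_of_fourCosets (f : CuspForm (Gamma0 N) 2) (hf0 : f ≠ 0) (A : ℕ → ℤ)
    (hAT : ∀ (p : ℕ) (hp : p.Prime), (haveI : NeZero p := ⟨hp.ne_zero⟩; heckeT (Gamma0 N) 2 p) f = ((A p : ℤ) : ℂ) • f)
    (𝔪 : Ideal (HeckeRing0 N 2)) (h𝔪 : ∀ t ∈ 𝔪, ∃ e : ℤ, HeckeRing0.toEnd N 2 t f = ((2 * e : ℤ) : ℂ) • f)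
    {v₁ v₂ : Module.Dual ℂ (CuspForm (Gamma0 N) 2)} (hv₁ : v₁ ∈ periodHomology N) (hv₂ : v₂ ∈ periodHomology N)
    (hcos : ∀ x ∈ periodHomology N,
      x ∈ 𝔪 • periodHomologyHecke N ∨ x - v₁ ∈ 𝔪 • periodHomologyHecke N ∨
      x - v₂ ∈ 𝔪 • periodHomologyHecke N ∨ x - (v₁ + v₂) ∈ 𝔪 • periodHomologyHecke N)
    (s : Finset (Gamma0 N → ZMod 2))
    (hs : ∀ χ ∈ s, (∀ γ γ' : Gamma0 N, χ (γ * γ') = χ γ + χ γ') ∧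
      (∀ γ γ' : Gamma0 N, periodFunctional N γ = periodFunctional N γ' → χ γ = χ γ') ∧
      (∀ (p : ℕ) (hp : p.Prime) (γ σ : Gamma0 N),
        periodFunctional N σ = (haveI : NeZero p := ⟨hp.ne_zero⟩; heckeT (Gamma0 N) 2 p).dualMap (periodFunctional N γ) →
        χ σ = ((A p : ℤ) : ZMod 2) * χ γ)) :
    s.card ≤ 4 := by
  classical
  -- `vᵢ = {∞, γᵢ∞}`
  have hr₁ : v₁ ∈ (periodHomology N : Set _) := hv₁
  have hr₂ : v₂ ∈ (periodHomology N : Set _) := hv₂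
  rw [coe_periodHomology_eq_range] at hr₁ hr₂
  obtain ⟨γ₁, hγ₁⟩ := hr₁
  obtain ⟨γ₂, hγ₂⟩ := hr₂
  have hv₁' : v₁ ∈ periodHomologyHecke N := (mem_periodHomologyHecke N).mpr hv₁
  have hv₂' : v₂ ∈ periodHomologyHecke N := (mem_periodHomologyHecke N).mpr hv₂
  -- the values of an eigencharacter are read off `(χ γ₁, χ γ₂)` and the coset of `{∞,γ∞}`
  have hval : ∀ χ ∈ s, ∀ γ : Gamma0 N,
      (periodFunctional N γ ∈ 𝔪 • periodHomologyHecke N → χ γ = 0) ∧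
      (periodFunctional N γ - v₁ ∈ 𝔪 • periodHomologyHecke N → χ γ = χ γ₁) ∧
      (periodFunctional N γ - v₂ ∈ 𝔪 • periodHomologyHecke N → χ γ = χ γ₂) ∧
      (periodFunctional N γ - (v₁ + v₂) ∈ 𝔪 • periodHomologyHecke N → χ γ = χ γ₁ + χ γ₂) := by
    intro χ hχ γ
    obtain ⟨ha, hb, hd⟩ := hs χ hχ
    obtain ⟨χt, hχt, hχu⟩ := exists_descend_eigenChar f A hAT χ ha hb hd
    have hkill : ∀ {z : Module.Dual ℂ (CuspForm (Gamma0 N) 2)} (hz : z ∈ 𝔪 • periodHomologyHecke N)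
        (hzΛ : z ∈ periodHomologyHecke N), χt ⟨z, hzΛ⟩ = 0 :=
      fun hz hzΛ ↦ descend_eigenChar_apply_eq_zero_of_mem_ideal_smul f hf0 χt hχu 𝔪 h𝔪 hz hzΛ
    have hγ : χ γ = χt ⟨periodFunctional N γ, periodFunctional_mem_periodHomology N γ⟩ := (hχt γ).symm
    have h₁ : χ γ₁ = χt ⟨v₁, hv₁'⟩ := by rw [← hχt γ₁]; congr 1; exact Subtype.ext hγ₁
    have h₂ : χ γ₂ = χt ⟨v₂, hv₂'⟩ := by rw [← hχt γ₂]; congr 1; exact Subtype.ext hγ₂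
    -- `χt x = χt w` whenever `x - w ∈ 𝔪Λ`
    have hsub : ∀ {w : Module.Dual ℂ (CuspForm (Gamma0 N) 2)} (hw : w ∈ periodHomologyHecke N),
        periodFunctional N γ - w ∈ 𝔪 • periodHomologyHecke N →
        χt ⟨periodFunctional N γ, periodFunctional_mem_periodHomology N γ⟩ = χt ⟨w, hw⟩ := by
      intro w hw hmem
      have hdΛ : periodFunctional N γ - w ∈ periodHomologyHecke N :=
        sub_mem ((mem_periodHomologyHecke N).mpr (periodFunctional_mem_periodHomology N γ)) hw
      have h0 := hkill hmem hdΛ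
      have e : (⟨periodFunctional N γ - w, hdΛ⟩ : periodHomologyHecke N) =
          ⟨periodFunctional N γ, periodFunctional_mem_periodHomology N γ⟩ - ⟨w, hw⟩ := Subtype.ext rfl
      rw [e, map_sub, sub_eq_zero] at h0
      exact h0
    refine ⟨fun h ↦ ?_, fun h ↦ ?_, fun h ↦ ?_, fun h ↦ ?_⟩
    · rw [hγ]; exact hkill h _
    · rw [hγ, h₁]; exact hsub hv₁' h
    · rw [hγ, h₂]; exact hsub hv₂' h
    · rw [hγ, h₁, h₂, ← map_add]; exact hsub (add_mem hv₁' hv₂') h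
  -- the signature map is injective on `s`
  let Φ : (Gamma0 N → ZMod 2) → ZMod 2 × ZMod 2 := fun χ ↦ (χ γ₁, χ γ₂)
  have hinj : Set.InjOn Φ s := by
    intro χ hχ χ' hχ' hΦ
    simp only [Φ, Prod.mk.injEq] at hΦ
    obtain ⟨e₁, e₂⟩ := hΦ
    funext γ
    obtain ⟨a0, a1, a2, a3⟩ := hval χ hχ γ
    obtain ⟨b0, b1, b2, b3⟩ := hval χ' hχ' γ
    rcases hcos (periodFunctional N γ) (periodFunctional_mem_periodHomology N γ) with h | h | h | h
    · rw [a0 h, b0 h]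
    · rw [a1 h, b1 h, e₁]
    · rw [a2 h, b2 h, e₂]
    · rw [a3 h, b3 h, e₁, e₂]
  calc s.card ≤ (Finset.univ : Finset (ZMod 2 × ZMod 2)).card :=
        Finset.card_le_card_of_injOn Φ (fun _ _ ↦ Finset.mem_univ _) hinj
    _ = 4 := by simp

end FourCosets

/-! ## §3. (I) for the habitat⁺ newform from the named facts -/

section Habitat

variable {W : WeierstrassCurve ℚ} [W.IsElliptic] [W.IsGloballyMinimal]

/-- **Hypothesis (I) «at most four mod-2 eigencharacters» for the newform of a good-supersingular-at-`2` curve, from the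
named facts.** `W/ℚ` globally minimal with `GoodSS W 2`, newform `f` of level `N_W` (`IsNewformOf W f`, eigenvalues
`A p = a_p(W)`). GRANTED `buzzard2000_multiplicityOne_gamma0` (Buzzard 2000 Prop. 2.4),
`serre1972_supersingular_decompositionSubgroup_image` (Serre 1972 Prop. 12: `ρ̄_{W,2}(D₂) = GL₂(𝔽₂)`) and
`heckeSelfDual_torsionBy_J0` (DDT Lemma 1.38 mod `2`): every finite set of additive maps `Γ₀(N_W) → ZMod 2` through the period
functional that are Hecke eigencharacters with `A p mod 2` at all primes has at most `4` elements. Route: the eigen-ideal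
`𝔪₀ = (2, T_p − A p : p)` acts on `f` by even integers (`ideal_span_acts_even`), so `𝔪₀ ≠ ⊤`, `|𝕋/𝔪₀| = 2`, `𝔪₀` maximal;
`finrank_torsionBySet_eq_two_of_facts` (sub form) and `exists_fourCosets_periodHomology_of_multiplicityOne` (quotient form)
give the four cosets; §2 concludes. [cite: Buzzard2000LevelLoweringModTwo, Prop. 2.4 and Def. 2.1–2.2 (p. 100–101)]
[cite: SerreInventiones1972, §1.11 Prop. 12 (c),(d)] [cite: DarmonDiamondTaylor1995, §1.6 Lemma 1.38 (p. 41) and §4.5 (p. 134)] -/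
theorem card_eigenChar_le_four_of_facts (hBuz : buzzard2000_multiplicityOne_gamma0)
    (hSe : serre1972_supersingular_decompositionSubgroup_image) (hSD : heckeSelfDual_torsionBy_J0)
    (hss : GoodSS W 2) [NeZero (W.conductorNorm ℤ)] {f : CuspForm (Gamma0 (W.conductorNorm ℤ)) 2} (hf : IsNewformOf W f)
    (A : ℕ → ℤ) (hA : ∀ p : ℕ, p.Prime → cuspCoeff f p = (A p : ℂ))
    (s : Finset (Gamma0 (W.conductorNorm ℤ) → ZMod 2))
    (hs : ∀ χ ∈ s, (∀ γ γ' : Gamma0 (W.conductorNorm ℤ), χ (γ * γ') = χ γ + χ γ') ∧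
      (∀ γ γ' : Gamma0 (W.conductorNorm ℤ),
        periodFunctional (W.conductorNorm ℤ) γ = periodFunctional (W.conductorNorm ℤ) γ' → χ γ = χ γ') ∧
      (∀ (p : ℕ) (hp : p.Prime) (γ σ : Gamma0 (W.conductorNorm ℤ)),
        periodFunctional (W.conductorNorm ℤ) σ =
          (haveI : NeZero p := ⟨hp.ne_zero⟩; heckeT (Gamma0 (W.conductorNorm ℤ)) 2 p).dualMap
            (periodFunctional (W.conductorNorm ℤ) γ) →
        χ σ = ((A p : ℤ) : ZMod 2) * χ γ)) :
    s.card ≤ 4 := by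
  classical
  have h2N : ¬ 2 ∣ W.conductorNorm ℤ := by
    rw [W.dvd_conductorNorm_iff_not_hasGoodReductionAtPrime 2, not_not]
    exact hss.1
  have hN : Odd (W.conductorNorm ℤ) := Nat.odd_iff.mpr (Nat.two_dvd_ne_zero.mp h2N)
  have hf0 : f ≠ 0 := hf.1.ne_zero
  have hAW : ∀ (p : ℕ), p.Prime → A p = W.LFunction p := fun p hp ↦ by
    have h := (hA p hp).symm.trans (hf.2 p)
    exact_mod_cast h
  have hAT : ∀ (p : ℕ) (hp : p.Prime),
      (haveI : NeZero p := ⟨hp.ne_zero⟩; heckeT (Gamma0 (W.conductorNorm ℤ)) 2 p) f = ((A p : ℤ) : ℂ) • f := by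
    intro p hp
    haveI : NeZero p := ⟨hp.ne_zero⟩
    rw [IsNewform0.heckeT_eq_coeff_smul hf.1 hp]
    change cuspCoeff f p • f = _
    rw [hA p hp]
  -- the eigen-ideal `𝔪₀ = (2, T_p − A p)`
  let G : Set (HeckeRing0 (W.conductorNorm ℤ) 2) := {t | t = 2 ∨ ∃ (p : ℕ) (hp : p.Prime),
    t = HeckeRing0.T (W.conductorNorm ℤ) 2 p hp - (A p : HeckeRing0 (W.conductorNorm ℤ) 2)}
  let 𝔪₀ : Ideal (HeckeRing0 (W.conductorNorm ℤ) 2) := Ideal.span G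
  have h2 : (2 : HeckeRing0 (W.conductorNorm ℤ) 2) ∈ 𝔪₀ := Ideal.subset_span (Or.inl rfl)
  have hev : ∀ t ∈ 𝔪₀, ∃ e : ℤ, HeckeRing0.toEnd (W.conductorNorm ℤ) 2 t f = ((2 * e : ℤ) : ℂ) • f :=
    ideal_span_acts_even f A hAT G subset_rfl
  have hne : 𝔪₀ ≠ ⊤ := by
    intro htop
    have h1 : (1 : HeckeRing0 (W.conductorNorm ℤ) 2) ∈ 𝔪₀ := htop ▸ Submodule.mem_top
    obtain ⟨e, he⟩ := hev 1 h1
    rw [map_one, Module.End.one_apply] at he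
    have h' : ((1 : ℤ) : ℂ) • f = ((2 * e : ℤ) : ℂ) • f := by rw [Int.cast_one, one_smul]; exact he
    have h'' : (((1 : ℤ) : ℂ) - ((2 * e : ℤ) : ℂ)) • f = 0 := by rw [sub_smul, h', sub_self]
    rcases smul_eq_zero.mp h'' with h3 | h3
    · have : (1 : ℤ) = 2 * e := by exact_mod_cast sub_eq_zero.mp h3
      omega
    · exact hf0 h3
  have hT' : ∀ (p : ℕ) (hp : p.Prime), ∃ n : ℤ,
      HeckeRing0.T (W.conductorNorm ℤ) 2 p hp - (n : HeckeRing0 (W.conductorNorm ℤ) 2) ∈ 𝔪₀ :=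
    fun p hp ↦ ⟨A p, Ideal.subset_span (Or.inr ⟨p, hp, rfl⟩)⟩
  have hq : Nat.card (HeckeRing0 (W.conductorNorm ℤ) 2 ⧸ 𝔪₀) = 2 := natCard_quotient_eq_two_of_ne_top 𝔪₀ h2 hT' hne
  haveI h𝔪max : 𝔪₀.IsMaximal := isMaximal_of_natCard_quotient_eq_two 𝔪₀ hq
  -- Buzzard's multiplicity one at `𝔪₀` (Galois side from Serre's Prop. 12)
  have hgood : ∀ v : HeightOneSpectrum (𝓞 ℚ), ¬ ((primesEquiv v : ℕ) ∣ 2 * W.conductorNorm ℤ) →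
      W.HasGoodReductionAt v := by
    intro v hv
    by_contra h
    exact hv (((W.dvd_conductorNorm_iff v).mpr h).mul_left 2)
  have hTW : ∀ (q : ℕ) (hq : q.Prime), ¬ q ∣ W.conductorNorm ℤ →
      HeckeRing0.T (W.conductorNorm ℤ) 2 q hq - (W.LFunction q : HeckeRing0 (W.conductorNorm ℤ) 2) ∈ 𝔪₀ := by
    intro q hq _
    rw [← hAW q hq]
    exact Ideal.subset_span (Or.inr ⟨q, hq, rfl⟩)
  have hsub := finrank_torsionBySet_eq_two_of_facts hBuz hSe W hss (W.conductorNorm ℤ) hN hgood 𝔪₀ h𝔪max h2 hq hTW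
  -- the Hecke self-duality of `J₀(N)[2]` and the four cosets
  obtain ⟨B, hbal, hleft, -⟩ := hSD (W.conductorNorm ℤ) 2
  obtain ⟨v₁, hv₁, v₂, hv₂, hcos⟩ := exists_fourCosets_periodHomology_of_multiplicityOne 𝔪₀ h2 hq hsub B hbal hleft
  exact card_eigenChar_le_four_of_fourCosets f hf0 A hAT 𝔪₀ hev hv₁ hv₂ hcos s hs

end Habitat

end MultOneDictionary

end Summit.BirchSwinnertonDyer.BirchSwinnertonDyer.Theorems.SignedMuAtTwo

end
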